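import Summits.ABC.IUTFork.Conditional.AbcOfSHregSplitBadWindow
import Literature.IUT.LogVolume.Corollary22PartIIPointwise
import Literature.IUT.LogVolume.FakeAdeleIndexLocalDegree
import Mathlib.RingTheory.Radical.NatInt
import HarnessLib

/-!
# Branch C, TARGET #1: the CONE binder `hreg` ⟹ an EXPLICIT lower bound for the RADICAL of `(4^m + 1)(4^{m+1} + 1)` —
# [IUTchIV] Thm. 1.10's display on the split-bad family over `ℚ(i)` unpacked, prime in the (P1) window
# (abc-iut cell, R2 S-chain team, seat abc-iut-s2-p3 gen 2; sequel of `AbcOfSHregSplitBadWindow`)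

Record-only PROOF file (D-0012) of the abc-iut cell; TAKES NO SIDE on [IUTchIII] Cor. 3.12 or [IUTchIV] Thm. 1.10.
S. Mochizuki, *IUT IV* [Mochizuki2012], Thm. 1.10 pp. 22–31 (display), Cor. 2.2 (ii) proof (P1), (P3) pp. 44–47
(«`(1/6)·log(q^{∤2}) − (1/6)·log(q) ≤ (1/6)·h^{1/2}·log(l)`»). [claim: Mochizuki2012, status: disputed] for every IUT quotation;
the content of THIS file is classical arithmetic of `ℤ[i]` (norms, radicals) plus Weil-height bookkeeping.

`Conditional.exists_display_of_hreg_window_of` (parent file) gives, from the CONE binder `hreg` of the S_H line of record, the display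
`Cor22.Display P_m l η` — `(1/6)·log(q^{∤{2,l}}(λ_m)) ≤ (1 + 20·d_mod/l)·(log-diff + log-cond^{∤{2,l}}) + 20·(2^12·3^3·5·d_mod·l + η)` —
at the split-bad points `P_m = (F, i2^m/(1 + i2^{m+1}))` of abc-iut-w5-d126 with an ADMISSIBLE prime `l` in the (P1) window. THIS FILE
evaluates the three arithmetic quantities of the display at `P_m`:

* `SplitBadWindow.log_le_logQNotTwo` — `log(1 + 4^{m+1}) ≤ log(q^{∤2}(λ_m))` (the poles above `1 + i2^{m+1}` are odd);
  with the tree's (P3)-lemma `Cor22.logQNotTwo_sub_logQAvoid_le`: `log(q^{∤{2,l}}(λ_m)) ≥ log(1 + 4^{m+1}) − h_m^{1/2}·log l`;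
* **`SplitBadWindow.two_mul_logCondAvoid_le_log_radical`** — `2·log-cond^{∤{2,l}}(λ_m) ≤ log rad((4^{m+1}+1)·(4^m+1))`: every odd
  bad place lies above a prime factor of `(4^{m+1}+1)(4^m+1)` (`mem_or_mem_of_mem_badPlaces`), and above each rational prime the bad
  places carry total weight `≤ 1/2` (the split-bad condition `sum_indicator_weight_le_half`), i.e. `Σ_{V bad, V | p} f_V·log p ≤ log p`;
* `SplitBadWindow.dmod_le_two`, `SplitBadWindow.exists_logQForall_le` — `d_mod(P_m) ≤ 2` and `h_m ≤ A + B·m` (Weil heights);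
* **`Conditional.log_radical_lower_bound_of_hreg_of`** (any model `F` of `ℚ(i)` with `i = ζ`, e.g. `CyclotomicField 4 ℚ` with
  `(IsCyclotomicExtension.zeta_spec 4 ℚ _).toInteger`) — `hreg` VERBATIM ⟹ ∃ `A B m₀` ∀ `m ≥ m₀` ∃ an admissible
  prime `l` ((P2), (P3), (P5), (P6) PROVED) with `h_m^{1/2} ≤ l ≤ 10δ₂·h_m^{1/2}·log(2δ₂h_m)`, `m + 1 ≤ h_m ≤ A + B·m`, and
  `(1/3)·log(4^{m+1} + 1) − (1/3)·h_m^{1/2}·log l − 80·d*·l − 40·η ≤ (1 + 40/l)·(2·log-diff(F) + log rad((4^{m+1}+1)(4^m+1)))`,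
  `d* = 2^12·3^3·5`, for every `η` with `IsEtaPrm η`.

READING (for the planners; nothing asserted about print or any author). The right side is `(1 + o(1))·log rad((4^m+1)(4^{m+1}+1)) + O(1)`
and the error terms on the left are `O(h_m^{1/2} log h_m) = O(m^{1/2} log m)`; so the CONE binder of the S_H line of record ALONE implies
`rad((4^m+1)·(4^{m+1}+1)) ≥ 4^{(1/3)·m − o(m)}` — an effective abc-type lower bound for the radical of the explicit sequence `4^n + 1`
(open in print; unconditional knowledge is of Stewart–Yu strength). Every hypothesis of [IUTchIV] Cor. 2.2 (ii) at `(P_m, l)` is a theorem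
of the tree. HONEST SCOPE: consequences of the typed binder; typed ≠ proved; no side taken. PROOF-ONLY file: no definitions, no `Prop` facts.
[cite: Mochizuki2012, IUTchIV Thm. 1.10 pp. 22–31] [cite: Mochizuki2012, IUTchIV Cor. 2.2 (ii) proof (P1)(P3) p. 44–47]
[cite: IrelandRosen1982, Ch. 9 §7 p. 120] [cite: MochizukiGenEll2010, Prop 1.4 (ii) p.6]
-/

noncomputable section

namespace Summit.ABC.IUTFork

open NumberField IsDedekindDomain Finset
open Literature.IUT.HodgeTheaters Literature.IUT.LogVolume Literature.IUT.LogVolume.Cor22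
open Literature.NumberTheory.DiophantineGeometry Literature.NumberTheory.DiophantineGeometry.GenEll
open Summit.ABC.ABC.Theorems
open scoped Classical

namespace SplitBadWindow

open SplitBadWitness

variable {F : Type} [Field F] [NumberField F] {ζ : 𝓞 F}

/-! ## §1. `log(q^{∤2}(λ_m)) ≥ log(1 + 4^{m+1})` -/

/-- **`log(1 + 4^{m+1}) ≤ log(q^{∤2}(λ_m))`**: the places above `1 + i2^{m+1}` are ODD bad places of local height `2·ord_V(1 + i2^{m+1})`
and `Σ_V ord_V(1 + i2^{m+1})·log N(V) = log(1 + 4^{m+1})` (abc-iut-w5-d126's `sum_ord_mul_logNorm_one_add`, `localHeight_of_mem`; the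
same computation as its `log_le_logQForall`, now avoiding `2`). [cite: Mochizuki2012, IUTchIV Cor 2.2 (i) p.41] [claim: Mochizuki2012, status: disputed] -/
theorem log_le_logQNotTwo [IsCyclotomicExtension {4} ℚ F] (hζ : IsPrimitiveRoot ζ 4) (m : ℕ) :
    Real.log (1 + 4 ^ (m + 1)) ≤ logQNotTwo (⟨F, (ζ : F) * 2 ^ m / (1 + (ζ : F) * 2 ^ (m + 1))⟩ : NFPoint) := by
  classical
  set T := (finite_setOf_ord_ne_zero F (1 + (ζ : F) * 2 ^ (m + 1))).toFinset with hT
  have hTmem : ∀ V ∈ T, 1 + ζ * 2 ^ (m + 1) ∈ V.asIdeal := by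
    intro V hV
    rw [hT, Set.Finite.mem_toFinset, Set.mem_setOf_eq] at hV
    have h0 : 0 ≤ ord F V (1 + (ζ : F) * 2 ^ (m + 1)) := by
      rw [← coe_one_add]; exact ord_nonneg_of_isIntegral F V _
    have hpos : 0 < ord F V (((1 + ζ * 2 ^ (m + 1) : 𝓞 F)) : F) := by rw [coe_one_add]; omega
    exact (ord_pos_iff_mem F V _ (one_add_ne_zero hζ (m + 1))).mp hpos
  have hdeg := degree_mul_logQAvoid (⟨F, (ζ : F) * 2 ^ m / (1 + (ζ : F) * 2 ^ (m + 1))⟩ : NFPoint) {2}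
  have hd : (((⟨F, (ζ : F) * 2 ^ m / (1 + (ζ : F) * 2 ^ (m + 1))⟩ : NFPoint).degree : ℕ) : ℝ) = 2 := by
    change ((Module.finrank ℚ F : ℕ) : ℝ) = 2; rw [finrank_eq_two F]; norm_num
  rw [hd] at hdeg
  change 2 * logQNotTwo (⟨F, (ζ : F) * 2 ^ m / (1 + (ζ : F) * 2 ^ (m + 1))⟩ : NFPoint) = _ at hdeg
  -- the poles above `1 + i2^{m+1}` are odd bad places, so they enter `log(q^{∤2})`
  have hle : ∑ V ∈ T, localHeight (⟨F, (ζ : F) * 2 ^ m / (1 + (ζ : F) * 2 ^ (m + 1))⟩ : NFPoint) V * logNorm F V ≤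
      2 * logQNotTwo (⟨F, (ζ : F) * 2 ^ m / (1 + (ζ : F) * 2 ^ (m + 1))⟩ : NFPoint) := by
    rw [hdeg]
    apply Finset.sum_le_sum_of_subset_of_nonneg
    · intro V hV
      rw [Finset.mem_filter]
      refine ⟨mem_badPlaces_of_mem hζ m V (hTmem V hV), fun q hq => ?_⟩
      rw [Finset.mem_singleton] at hq
      subst hq
      rw [Nat.cast_ofNat]
      exact two_notMem_of_mem V.isPrime.ne_top (hTmem V hV)
    · intro V _ _
      exact mul_nonneg (localHeight_nonneg (⟨F, (ζ : F) * 2 ^ m / (1 + (ζ : F) * 2 ^ (m + 1))⟩ : NFPoint) V)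
        (logNorm_pos F V).le
  have hT' : ∑ V ∈ T, localHeight (⟨F, (ζ : F) * 2 ^ m / (1 + (ζ : F) * 2 ^ (m + 1))⟩ : NFPoint) V * logNorm F V =
      2 * Real.log (1 + 4 ^ (m + 1)) := by
    rw [← sum_ord_mul_logNorm_one_add hζ m, Finset.mul_sum]
    refine Finset.sum_congr rfl fun V hV => ?_
    rw [localHeight_of_mem hζ m V (hTmem V hV)]
    ring
  linarith

/-- **`log(q^{∤{2,l}}(λ_m)) ≥ log(1 + 4^{m+1}) − h_m^{1/2}·log l`** under (P3) at `(P_m, l)` (the tree's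
`Cor22.logQNotTwo_sub_logQAvoid_le`, [IUTchIV] p. 47). [cite: Mochizuki2012, IUTchIV Cor. 2.2 (ii) proof p. 47] [claim: Mochizuki2012, status: disputed] -/
theorem log_sub_le_logQAvoid [IsCyclotomicExtension {4} ℚ F] (hζ : IsPrimitiveRoot ζ 4) (m : ℕ) {l : ℕ} (hl : l.Prime)
    (hP3 : ∀ v ∈ badPlaces (⟨F, (ζ : F) * 2 ^ m / (1 + (ζ : F) * 2 ^ (m + 1))⟩ : NFPoint), residueChar F v = l →
      localHeight (⟨F, (ζ : F) * 2 ^ m / (1 + (ζ : F) * 2 ^ (m + 1))⟩ : NFPoint) v <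
        Real.sqrt (logQForall (⟨F, (ζ : F) * 2 ^ m / (1 + (ζ : F) * 2 ^ (m + 1))⟩ : NFPoint))) :
    Real.log (1 + 4 ^ (m + 1)) -
        Real.sqrt (logQForall (⟨F, (ζ : F) * 2 ^ m / (1 + (ζ : F) * 2 ^ (m + 1))⟩ : NFPoint)) * Real.log l ≤
      logQAvoid (⟨F, (ζ : F) * 2 ^ m / (1 + (ζ : F) * 2 ^ (m + 1))⟩ : NFPoint) {2, l} := by
  have h1 := log_le_logQNotTwo hζ m
  have h2 := logQNotTwo_sub_logQAvoid_le (⟨F, (ζ : F) * 2 ^ m / (1 + (ζ : F) * 2 ^ (m + 1))⟩ : NFPoint) hl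
    (Real.sqrt_nonneg _) (fun v hv hres => (hP3 v hv hres).le)
  linarith

/-! ## §2. `2·log-cond^{∤{2,l}}(λ_m) ≤ log rad((4^{m+1}+1)(4^m+1))` -/

/-- **The conductor of `λ_m` against the radical of `(4^{m+1}+1)(4^m+1)`**: `2·log-cond^{∤{2,l}}(P_m) ≤ log rad((4^{m+1}+1)·(4^m+1))`.
Every ODD bad place `V` contains `1 + i2^{m+1}` or `1 + i2^m` (`mem_or_mem_of_mem_badPlaces`), so its residue characteristic divides
`(4^{m+1}+1)(4^m+1)`; above each rational prime `p` the bad places off `{2,l}` carry `Σ n_V ≤ [F:ℚ]·(1/2)·2 = 1`-worth of weight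
(`sum_indicator_weight_le_half`), whence `Σ_{V bad | p} log N(V) = Σ f_V·log p ≤ log p`; summing over the prime factors gives the radical.
[cite: Mochizuki2012, IUTchIV Thm. 1.10 p. 23] [cite: IrelandRosen1982, Ch. 9 §7 p. 120] [claim: Mochizuki2012, status: disputed] -/
theorem two_mul_logCondAvoid_le_log_radical [IsCyclotomicExtension {4} ℚ F] (hζ : IsPrimitiveRoot ζ 4) (m : ℕ) (l : ℕ) :
    2 * logCondAvoid (⟨F, (ζ : F) * 2 ^ m / (1 + (ζ : F) * 2 ^ (m + 1))⟩ : NFPoint) {2, l} ≤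
      Real.log (UniqueFactorizationMonoid.radical ((4 ^ (m + 1) + 1) * (4 ^ m + 1)) : ℕ) := by
  classical
  set Pm : NFPoint := ⟨F, (ζ : F) * 2 ^ m / (1 + (ζ : F) * 2 ^ (m + 1))⟩ with hPm
  set N : ℕ := (4 ^ (m + 1) + 1) * (4 ^ m + 1) with hN
  have hN0 : N ≠ 0 := by positivity
  set B := badPlacesAvoid Pm {2, l} with hB
  have hdeg : ((Pm.degree : ℕ) : ℝ) = 2 := by
    change ((Module.finrank ℚ F : ℕ) : ℝ) = 2; rw [finrank_eq_two F]; norm_num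
  -- `2·log-cond = Σ_{V ∈ B} log N(V)`
  have hsum : 2 * logCondAvoid Pm {2, l} = ∑ V ∈ B, logNorm F V := by
    rw [logCondAvoid_eq_sum, hdeg]
    have : ∑ v ∈ badPlacesAvoid Pm {2, l}, Real.log ((Ideal.absNorm v.asIdeal : ℕ) : ℝ) = ∑ V ∈ B, logNorm F V := rfl
    rw [this]; ring
  rw [hsum]
  -- facts about `V ∈ B`
  have hB2 : ∀ V ∈ B, (2 : 𝓞 F) ∉ V.asIdeal := by
    intro V hV
    have h := (Finset.mem_filter.mp hV).2 2 (by simp)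
    rwa [Nat.cast_ofNat] at h
  have hBbad : ∀ V ∈ B, V ∈ badPlaces Pm := fun V hV => (Finset.mem_filter.mp hV).1
  have hchar : ∀ V ∈ B, residueChar F V ∈ N.primeFactors := by
    intro V hV
    have hp := residueChar_prime F V
    have hpV : ((residueChar F V : ℕ) : 𝓞 F) ∈ V.asIdeal := natCast_residueChar_mem F V
    refine Nat.mem_primeFactors.mpr ⟨hp, ?_, hN0⟩
    rcases mem_or_mem_of_mem_badPlaces hζ m V (hB2 V hV) (hBbad V hV) with hβ | hγ
    · have hNβ : ((1 + 4 ^ (m + 1) : ℕ) : 𝓞 F) ∈ V.asIdeal := by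
        rw [← one_add_mul_one_sub hζ]; exact V.asIdeal.mul_mem_right _ hβ
      have h1 : residueChar F V ∣ 1 + 4 ^ (m + 1) := dvd_of_natCast_mem V.isPrime.ne_top hp hpV hNβ
      rw [hN, show 4 ^ (m + 1) + 1 = 1 + 4 ^ (m + 1) from add_comm _ _]
      exact dvd_mul_of_dvd_left h1 _
    · have hNγ : ((1 + 4 ^ m : ℕ) : 𝓞 F) ∈ V.asIdeal := by
        rw [← one_add_mul_one_sub hζ]; exact V.asIdeal.mul_mem_right _ hγ
      have h1 : residueChar F V ∣ 1 + 4 ^ m := dvd_of_natCast_mem V.isPrime.ne_top hp hpV hNγ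
      rw [hN, show 4 ^ m + 1 = 1 + 4 ^ m from add_comm _ _]
      exact dvd_mul_of_dvd_right h1 _
  -- regroup by residue characteristic
  rw [← Finset.sum_fiberwise_of_maps_to hchar]
  -- per prime: `Σ_{V ∈ B, p_V = p} log N(V) ≤ log p`
  have hper : ∀ p ∈ N.primeFactors, ∑ V ∈ B with residueChar F V = p, logNorm F V ≤ Real.log p := by
    intro p hp
    haveI : Fact p.Prime := ⟨Nat.prime_of_mem_primeFactors hp⟩
    have hlogp : 0 ≤ Real.log p := Real.log_nonneg (by exact_mod_cast (Nat.prime_of_mem_primeFactors hp).one_lt.le)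
    have hsub : B.filter (fun V => residueChar F V = p) ⊆ placesOver F p := fun V hV =>
      (mem_placesOver_iff_residueChar V).mpr (Finset.mem_filter.mp hV).2
    -- `log N(V) ≤ n_V · log p` on the fibre
    have hterm : ∀ V ∈ B.filter (fun V => residueChar F V = p),
        logNorm F V ≤ (B : Set (HeightOneSpectrum (𝓞 F))).indicator (fun V => (localDegree F V : ℝ)) V * Real.log p := by
      intro V hV
      have hVB : V ∈ B := (Finset.mem_filter.mp hV).1
      have hres : residueChar F V = p := (Finset.mem_filter.mp hV).2
      rw [Set.indicator_of_mem (Finset.mem_coe.mpr hVB), logNorm_eq, hres]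
      have hf : (resDeg F V : ℝ) ≤ localDegree F V := by
        have : resDeg F V ≤ localDegree F V := by
          unfold localDegree
          exact Nat.le_mul_of_pos_left _ (Nat.pos_of_ne_zero (ramIdx_ne_zero F V))
        exact_mod_cast this
      exact mul_le_mul_of_nonneg_right hf hlogp
    have hw : ∑ V ∈ placesOver F p, (B : Set (HeightOneSpectrum (𝓞 F))).indicator (weight F) V ≤ 1 / 2 := by
      rw [← Finset.sum_coe_sort]
      exact sum_indicator_weight_le_half hζ m {2, l} (by simp) p
    -- indicator of weight = indicator of n_V / 2
    have hwt : ∀ V : HeightOneSpectrum (𝓞 F),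
        (B : Set (HeightOneSpectrum (𝓞 F))).indicator (weight F) V =
          (B : Set (HeightOneSpectrum (𝓞 F))).indicator (fun V => (localDegree F V : ℝ)) V / 2 := by
      intro V
      by_cases hVB : V ∈ (B : Set (HeightOneSpectrum (𝓞 F)))
      · rw [Set.indicator_of_mem hVB, Set.indicator_of_mem hVB, weight, finrank_eq_two F]; norm_num
      · rw [Set.indicator_of_notMem hVB, Set.indicator_of_notMem hVB]; simp
    have hw' : ∑ V ∈ placesOver F p, (B : Set (HeightOneSpectrum (𝓞 F))).indicator (fun V => (localDegree F V : ℝ)) V ≤ 1 := by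
      have : ∑ V ∈ placesOver F p, (B : Set (HeightOneSpectrum (𝓞 F))).indicator (weight F) V =
          (∑ V ∈ placesOver F p, (B : Set (HeightOneSpectrum (𝓞 F))).indicator (fun V => (localDegree F V : ℝ)) V) / 2 := by
        rw [Finset.sum_div]
        exact Finset.sum_congr rfl fun V _ => hwt V
      rw [this] at hw
      linarith
    calc ∑ V ∈ B with residueChar F V = p, logNorm F V
        ≤ ∑ V ∈ B with residueChar F V = p,
            (B : Set (HeightOneSpectrum (𝓞 F))).indicator (fun V => (localDegree F V : ℝ)) V * Real.log p :=
          Finset.sum_le_sum hterm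
      _ ≤ ∑ V ∈ placesOver F p, (B : Set (HeightOneSpectrum (𝓞 F))).indicator (fun V => (localDegree F V : ℝ)) V * Real.log p :=
          Finset.sum_le_sum_of_subset_of_nonneg hsub fun V _ _ =>
            mul_nonneg (Set.indicator_nonneg (fun _ _ => by positivity) _) hlogp
      _ = (∑ V ∈ placesOver F p, (B : Set (HeightOneSpectrum (𝓞 F))).indicator (fun V => (localDegree F V : ℝ)) V) * Real.log p := by
          rw [Finset.sum_mul]
      _ ≤ 1 * Real.log p := mul_le_mul_of_nonneg_right hw' hlogp
      _ = Real.log p := one_mul _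
  -- sum over the prime factors: the log of the radical
  calc ∑ p ∈ N.primeFactors, ∑ V ∈ B with residueChar F V = p, logNorm F V
      ≤ ∑ p ∈ N.primeFactors, Real.log p := Finset.sum_le_sum hper
    _ = Real.log (UniqueFactorizationMonoid.radical N : ℕ) := by
        rw [Nat.radical_eq_prod_primeFactors, Nat.cast_prod, Real.log_prod]
        intro p hp
        exact_mod_cast (Nat.prime_of_mem_primeFactors hp).ne_zero

/-! ## §3. `d_mod(P_m) ≤ 2` and the height `h_m ≤ A + B·m` -/

/-- `d_mod(P) ≤ [F:ℚ] = 2` for every point presented over `F` (tower law). [cite: MochizukiGenEll2010, Def 1.5 (i) p.8] -/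
theorem dmod_le_two [IsCyclotomicExtension {4} ℚ F] (x : F) : dmod (⟨F, x⟩ : NFPoint) ≤ 2 := by
  change Module.finrank ℚ (IntermediateField.adjoin ℚ ({jInv x} : Set F)) ≤ 2
  have htower : Module.finrank ℚ (IntermediateField.adjoin ℚ ({jInv x} : Set F)) *
      Module.finrank (IntermediateField.adjoin ℚ ({jInv x} : Set F)) F = 2 := by
    rw [Module.finrank_mul_finrank, finrank_eq_two F]
  exact Nat.le_of_dvd (by norm_num) ⟨_, htower.symm⟩

/-- **`h_m = log(q^∀(λ_m)) ≤ A + B·m`** with `A, B ≥ 0` depending only on `F` and `i` (Weil heights: `log(q^∀) ≤ ht_∞ = (1/2)·h(j(λ_m))`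
by `Cor22.logQForall_le_htInfty`; `h(j(λ)) ≤ 11W + 8h(2) + 13h(λ)` for `j = 2^8(λ²−λ+1)^3/(λ²(λ−1)^2)`, `W = [F:ℚ]·log 2`;
`h(λ_m) ≤ W + 2h(i) + (2m+1)·h(2)` — Mathlib `Height.logHeight₁_{mul,add,sub}_le/_inv/_pow`). [cite: MochizukiGenEll2010, Prop 1.4 (ii) p.6] -/
theorem exists_logQForall_le [IsCyclotomicExtension {4} ℚ F] (ζ : 𝓞 F) :
    ∃ A B : ℝ, 0 ≤ A ∧ 0 ≤ B ∧ ∀ m : ℕ,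
      logQForall (⟨F, (ζ : F) * 2 ^ m / (1 + (ζ : F) * 2 ^ (m + 1))⟩ : NFPoint) ≤ A + B * m := by
  set W : ℝ := (Height.totalWeight F : ℝ) * Real.log 2 with hW
  set h2 : ℝ := Height.logHeight₁ (2 : F) with hh2
  set hi : ℝ := Height.logHeight₁ (ζ : F) with hhi
  have hnn : ∀ y : F, 0 ≤ Height.logHeight₁ y := fun y => by
    rw [Height.logHeight₁_eq_log_mulHeight₁]; exact Real.log_nonneg (Height.one_le_mulHeight₁ _)
  have hW0 : 0 ≤ W := by positivity
  have h20 : 0 ≤ h2 := hnn _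
  have hi0 : 0 ≤ hi := hnn _
  -- `h(λ_m) ≤ W + 2·h(i) + (2m+1)·h(2)`
  have hlam : ∀ m : ℕ, Height.logHeight₁ ((ζ : F) * 2 ^ m / (1 + (ζ : F) * 2 ^ (m + 1))) ≤
      W + 2 * hi + (2 * m + 1) * h2 := by
    intro m
    rw [div_eq_mul_inv]
    refine (Height.logHeight₁_mul_le _ _).trans ?_
    rw [Height.logHeight₁_inv]
    have ha : Height.logHeight₁ ((ζ : F) * 2 ^ m) ≤ hi + m * h2 := by
      refine (Height.logHeight₁_mul_le _ _).trans ?_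
      rw [Height.logHeight₁_pow]
    have hb : Height.logHeight₁ (1 + (ζ : F) * 2 ^ (m + 1)) ≤ W + 0 + (hi + (m + 1) * h2) := by
      refine (Height.logHeight₁_add_le _ _).trans ?_
      rw [Height.logHeight₁_one]
      have : Height.logHeight₁ ((ζ : F) * 2 ^ (m + 1)) ≤ hi + (m + 1) * h2 := by
        refine (Height.logHeight₁_mul_le _ _).trans ?_
        rw [Height.logHeight₁_pow]; push_cast; exact le_rfl
      linarith
    nlinarith
  -- `h(j(λ)) ≤ 11W + 8h(2) + 13h(λ)`
  have hj : ∀ x : F, Height.logHeight₁ (jInv x) ≤ 11 * W + 8 * h2 + 13 * Height.logHeight₁ x := by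
    intro x
    set hx : ℝ := Height.logHeight₁ x with hhx
    have hx0 : 0 ≤ hx := hnn _
    unfold jInv
    rw [div_eq_mul_inv]
    refine (Height.logHeight₁_mul_le _ _).trans ?_
    rw [Height.logHeight₁_inv]
    have hA : Height.logHeight₁ ((2 : F) ^ 8 * (x ^ 2 - x + 1) ^ 3) ≤ 8 * h2 + 3 * (2 * W + 3 * hx) := by
      refine (Height.logHeight₁_mul_le _ _).trans ?_
      rw [Height.logHeight₁_pow, Height.logHeight₁_pow]
      have hq : Height.logHeight₁ (x ^ 2 - x + 1) ≤ 2 * W + 3 * hx := by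
        refine (Height.logHeight₁_add_le _ _).trans ?_
        rw [Height.logHeight₁_one]
        have : Height.logHeight₁ (x ^ 2 - x) ≤ W + 2 * hx + hx := by
          refine (Height.logHeight₁_sub_le _ _).trans ?_
          rw [Height.logHeight₁_pow]
          push_cast; linarith
        linarith
      push_cast
      nlinarith
    have hB : Height.logHeight₁ (x ^ 2 * (x - 1) ^ 2) ≤ 2 * hx + 2 * (W + hx) := by
      refine (Height.logHeight₁_mul_le _ _).trans ?_
      rw [Height.logHeight₁_pow, Height.logHeight₁_pow]
      have : Height.logHeight₁ (x - 1) ≤ W + hx + 0 := by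
        refine (Height.logHeight₁_sub_le _ _).trans ?_
        rw [Height.logHeight₁_one]
      push_cast
      nlinarith
    linarith
  refine ⟨(11 * W + 8 * h2 + 13 * (W + 2 * hi + h2)) / 2, 13 * h2, by positivity, by positivity, fun m => ?_⟩
  set Pm : NFPoint := ⟨F, (ζ : F) * 2 ^ m / (1 + (ζ : F) * 2 ^ (m + 1))⟩ with hPm
  have hdeg : ((Pm.degree : ℕ) : ℝ) = 2 := by
    change ((Module.finrank ℚ F : ℕ) : ℝ) = 2
    rw [finrank_eq_two F]; norm_num
  have h1 := logQForall_le_htInfty Pm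
  have h2'' : htInfty Pm = 2⁻¹ * Height.logHeight₁ (jInv ((ζ : F) * 2 ^ m / (1 + (ζ : F) * 2 ^ (m + 1)))) := by
    unfold htInfty
    rw [hdeg]
  rw [h2''] at h1
  have h3 := hj ((ζ : F) * 2 ^ m / (1 + (ζ : F) * 2 ^ (m + 1)))
  have h4 := hlam m
  nlinarith

end SplitBadWindow

/-! ## §4. The CONE binder ⟹ a lower bound for `rad((4^{m+1}+1)(4^m+1))` -/

namespace Conditional

open SplitBadWitness SplitBadWindow

/-- **`hreg` ⟹ an explicit lower bound for `log rad((4^{m+1}+1)(4^m+1))` (any model `F` of `ℚ(i)`).** Assume `hreg` VERBATIM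
(v4 p431657 = v6K p437297). For every `η` with `IsEtaPrm η` there are `A, B ≥ 0` and `m₀` such that for all `m ≥ m₀` there is a prime
`l ≥ 7` with (P2), (P3), (P5), (P6) at `P_m = (F, i2^m/(1 + i2^{m+1}))` PROVED, `h_m^{1/2} ≤ l ≤ 10δ₂·h_m^{1/2}·log(2δ₂h_m)`,
`m + 1 ≤ h_m ≤ A + B·m`, and
`(1/3)·log(1 + 4^{m+1}) − (1/3)·h_m^{1/2}·log l − 80·(2^12·3^3·5)·l − 40·η ≤ (1 + 40/l)·(2·log-diff(P_m) + log rad((4^{m+1}+1)(4^m+1)))`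
(Thm. 1.10's display at `(P_m, l)` from the parent file, times `2`, with `d_mod ≤ 2`, `log(q^{∤{2,l}}) ≥ log(1+4^{m+1}) − h^{1/2} log l`
and `2·log-cond ≤ log rad`). Nothing asserted about any point, about print, or about any author; typed ≠ proved.
[cite: Mochizuki2012, IUTchIV Thm. 1.10 pp. 22–31] [cite: Mochizuki2012, IUTchIV Cor. 2.2 (ii) proof (P1)–(P7) p. 44–47]
[claim: Mochizuki2012, status: disputed] -/
theorem log_radical_lower_bound_of_hreg_of (F : Type) [Field F] [NumberField F] [IsCyclotomicExtension {4} ℚ F]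
    {ζ : 𝓞 F} (hζ : IsPrimitiveRoot ζ 4)
    (hreg : ∀ P : NFPoint, P ∈ UP → ∀ l : ℕ, l.Prime → 5 ≤ l →
      Cor22.AdmitsCore P → Cor22.CondP2 P l → Cor22.CondP5 P l → Cor22.CondP6 P l →
      ∀ T : Cor22.ThetaVolumeDatumAt P l,
        (letI := T.instFieldF; letI := T.instNumberFieldF; letI := T.instAlgebraF; letI := T.instFieldK
         letI := T.instNumberFieldK; letI := T.instAlgebraK; letI := T.instFieldFbar; letI := T.instAlgebraFbar
         letI := T.instAlgebraKFbar; letI := T.instIsElliptic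
         ¬ (∀ p ∈ T.I.supportPrimes, ∀ v w : placesOver (fieldOfModuli T.E) p,
            (Summit.ABC.IUTFork.DHData.ofInput T.I).logQloc p v = (Summit.ABC.IUTFork.DHData.ofInput T.I).logQloc p w)) →
        T.HullEstimateOf
          (((l : ℝ) + 1) / 4 *
            ((1 + 12 * (Cor22.dmod P : ℝ) / l) * (P.logDiff + Cor22.logCondAvoid P {2, l})
              + 2 * Real.log l + 52
              + 20 / 3 * Real.log (((2 ^ 12 * 3 ^ 3 * 5 * Cor22.dmod P : ℕ) : ℝ) * (l : ℝ))
                * (Nat.primeCounting (2 ^ 12 * 3 ^ 3 * 5 * Cor22.dmod P * l) : ℝ))))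
    {η : ℝ} (hη : IsEtaPrm η) :
    ∃ (A B : ℝ) (m₀ : ℕ), 0 ≤ A ∧ 0 ≤ B ∧ ∀ m : ℕ, m₀ ≤ m →
      ∃ l : ℕ, l.Prime ∧ 7 ≤ l ∧
        CondP2 (⟨F, (ζ : F) * 2 ^ m / (1 + (ζ : F) * 2 ^ (m + 1))⟩ : NFPoint) l ∧
        CondP5 (⟨F, (ζ : F) * 2 ^ m / (1 + (ζ : F) * 2 ^ (m + 1))⟩ : NFPoint) l ∧
        CondP6 (⟨F, (ζ : F) * 2 ^ m / (1 + (ζ : F) * 2 ^ (m + 1))⟩ : NFPoint) l ∧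
        Real.sqrt (logQForall (⟨F, (ζ : F) * 2 ^ m / (1 + (ζ : F) * 2 ^ (m + 1))⟩ : NFPoint)) ≤ l ∧
        (l : ℝ) ≤ 10 * delta 2 * Real.sqrt (logQForall (⟨F, (ζ : F) * 2 ^ m / (1 + (ζ : F) * 2 ^ (m + 1))⟩ : NFPoint)) *
          Real.log (2 * delta 2 * logQForall (⟨F, (ζ : F) * 2 ^ m / (1 + (ζ : F) * 2 ^ (m + 1))⟩ : NFPoint)) ∧
        ((m : ℝ) + 1) ≤ logQForall (⟨F, (ζ : F) * 2 ^ m / (1 + (ζ : F) * 2 ^ (m + 1))⟩ : NFPoint) ∧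
        logQForall (⟨F, (ζ : F) * 2 ^ m / (1 + (ζ : F) * 2 ^ (m + 1))⟩ : NFPoint) ≤ A + B * m ∧
        1 / 3 * Real.log (1 + 4 ^ (m + 1))
            - 1 / 3 * Real.sqrt (logQForall (⟨F, (ζ : F) * 2 ^ m / (1 + (ζ : F) * 2 ^ (m + 1))⟩ : NFPoint)) * Real.log l
            - 80 * (2 ^ 12 * 3 ^ 3 * 5) * l - 40 * η ≤
          (1 + 40 / (l : ℝ)) *
            (2 * (⟨F, (ζ : F) * 2 ^ m / (1 + (ζ : F) * 2 ^ (m + 1))⟩ : NFPoint).logDiff +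
              Real.log (UniqueFactorizationMonoid.radical ((4 ^ (m + 1) + 1) * (4 ^ m + 1)) : ℕ)) := by
  obtain ⟨A, B, hA, hB, hAB⟩ := exists_logQForall_le (F := F) ζ
  obtain ⟨m₀, hm₀⟩ := exists_display_of_hreg_window_of F hζ hreg hη
  refine ⟨A, B, m₀, hA, hB, fun m hm => ?_⟩
  obtain ⟨l, hlp, hl7, hP2, hP5, hP6, hP3, hlo, hhi, hh, hdisp⟩ := hm₀ m hm
  refine ⟨l, hlp, hl7, hP2, hP5, hP6, hlo, hhi, hh, hAB m, ?_⟩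
  set Pm : NFPoint := ⟨F, (ζ : F) * 2 ^ m / (1 + (ζ : F) * 2 ^ (m + 1))⟩ with hPm
  -- unpack the display
  have hD : 1 / 6 * logQAvoid Pm {2, l} ≤
      (1 + 20 * (dmod Pm : ℝ) / l) * (Pm.logDiff + logCondAvoid Pm {2, l})
        + 20 * (2 ^ 12 * 3 ^ 3 * 5 * (dmod Pm : ℝ) * l + η) := hdisp
  have hl0 : (0 : ℝ) < l := by exact_mod_cast hlp.pos
  have hd2' : dmod Pm ≤ 2 := dmod_le_two (F := F) _
  have hd2 : (dmod Pm : ℝ) ≤ 2 := by exact_mod_cast hd2'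
  have hd0 : (0 : ℝ) ≤ dmod Pm := by positivity
  have hDC0 : 0 ≤ Pm.logDiff + logCondAvoid Pm {2, l} :=
    add_nonneg (NFPoint.logDiff_nonneg _) (logCondAvoid_nonneg _ _)
  -- `(1 + 20 d/l) ≤ (1 + 40/l)` and `d*·d·l ≤ 2 d* l`
  have hcoef : (1 + 20 * (dmod Pm : ℝ) / l) * (Pm.logDiff + logCondAvoid Pm {2, l}) ≤
      (1 + 40 / (l : ℝ)) * (Pm.logDiff + logCondAvoid Pm {2, l}) := by
    refine mul_le_mul_of_nonneg_right ?_ hDC0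
    have : 20 * (dmod Pm : ℝ) / l ≤ 40 / l := by
      rw [div_le_div_iff_of_pos_right hl0]; linarith
    linarith
  have hconst : 20 * (2 ^ 12 * 3 ^ 3 * 5 * (dmod Pm : ℝ) * l + η) ≤ 40 * (2 ^ 12 * 3 ^ 3 * 5) * l + 20 * η := by
    nlinarith
  have hq := log_sub_le_logQAvoid hζ m hlp hP3
  have hrad := two_mul_logCondAvoid_le_log_radical hζ m l
  have hc40 : (0 : ℝ) ≤ 1 + 40 / (l : ℝ) := by positivity
  have hkey : (1 + 40 / (l : ℝ)) * (2 * (Pm.logDiff + logCondAvoid Pm {2, l})) ≤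
      (1 + 40 / (l : ℝ)) * (2 * Pm.logDiff +
        Real.log (UniqueFactorizationMonoid.radical ((4 ^ (m + 1) + 1) * (4 ^ m + 1)) : ℕ)) :=
    mul_le_mul_of_nonneg_left (by linarith) hc40
  nlinarith

end Conditional

end Summit.ABC.IUTFork

end
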